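/-
Origin: expansion seat `planner-pub-hodgecm-pv15-g2-0`, handover #1 2026-08-18T06:02:39Z (`HOME/pub-hodgecm-pv15-g2/lean/Pv15g2/ThetaCarrierReg.lean`, md5 3cf2819e, 442 lines);
landed by the gen-6 packager in gate run 24 as `HodgeCM/Automorphic/ThetaCarrierReg.lean` (import ^import Pv15g2\.→import HodgeCM.Automorphic. ×1).
-/
/-
Origin: HOME/pub-hodgecm-pv15-g2/lean/Pv15g2/ThetaCarrierReg.lean — session planner-pub-hodgecm-pv15-g2-0
(unit pub-hodgecm-pv15-g2, DAG-NODE PROVER #15 gen 2; lineage N23a / N31d).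
Intended final place (packager's call): `HodgeCM/Automorphic/ThetaCarrierReg.lean`; module rename
`Pv15g2.RegularRepresentation` ↦ `HodgeCM.Automorphic.RegularRepresentation` (mine, handed over with this file);
`HodgeCM.Automorphic.ThetaCarrierRep` (prl1 gen 3) is staged for gate run 23.
NEW, ADDITIVE; touches no existing file.

KIND: L2 (a smaller hypothesis record) + KERNEL (the discharges) + L5 glue (end-state corollaries).
Nothing is cited; nothing is posited.  The one published citation of the chain stays where prl1 gen 3 put it
(`RepCoreCarrier.Analytic.discreteDecomp`, carried over verbatim as `RegCoreCarrier.Analytic.discreteDecomp`).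
-/
import Summits.HodgeConjecture.HodgeCM.Automorphic.RegularRepresentation
import Summits.HodgeConjecture.HodgeCM.Automorphic.ThetaCarrierRep_2

set_option autoImplicit false

/-!
# The theta carrier in the regular-representation model — `R_unitary` and `AX12_E_transl` (N23a) discharged

Gen 3 of the realisation seat (`HodgeCM.Automorphic.ThetaCarrierRep`) left, per seesaw context, the hypothesis
records `RepCoreCarrier.Analytic` = {`R_unitary`, `discreteDecomp`, `hatτ_complete`} and, per torus side,
`RepTorusCarrier.Analytic` = {`AX5b_ϑ_cont`, `AX12_transl_cont`, `AX12_E_transl`, `AX12_unfold_lift`, `AX12_molly`,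
`AX8_annihilation`}: 3 + 6 + 6 = 15 named propositions, over carriers in which `H = L²([U(W)])`, the representation
`R`, the test functions `TestFn`, the pseudo-Eisenstein vectors `E` and the twist `ETransl` are bare DATA.

Here these five data are DEFINED (file `RegularRepresentation`):
* `H := Lp ℂ 2 μQ` on the coset space `G ⧸ Γ` (`G = U(W)(𝔸)`, `Γ = U(W)(L₀)` a discrete closed subgroup, `μQ` a
  `G`-invariant measure finite on compacts), `R := RegularRep.koopman μQ` (the regular representation);
* `TestFn := C_c(G, ℂ)`, `E χ f := RegularRep.EisL2 …` = the `L²` class of PerL's pseudo-Eisenstein series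
  (the LANDED node-N23a function `PerL34.N23a.Eis`, tex ll. 405–409), `ETransl h χ f := f^{h}` (`RegularRep.rTransCc`);
and for the resulting carriers (`RegCoreCarrier.toRepCoreCarrier`, `RegTorusCarrier.toRepTorusCarrier`) the two
propositions `R_unitary` (core) and `AX12_E_transl` (each torus side; PerL ll. 410–411 = DAG node **N23a**, the
carver's `N23a_pseudoEisenstein`) are KERNEL THEOREMS (`RegularRep.koopman_inner`, `RegularRep.koopman_EisL2`).
The hypothesis records shrink to `RegCoreCarrier.Analytic` (2 fields) + `RegTorusCarrier.Analytic` (5 fields) per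
torus side = **12 named propositions per seesaw context** (gen 3: 15; gen 2: 20), and every landed theorem over
`(D : U.RepThetaCarrier) (hA : D.Analytic)` applies to `D.toRepThetaCarrier` — in particular the cell's END STATE
(`Assembly.COR_CM_endState_ofRegCarrier_leaves'`).

Relation to the realisation seat's run-24 files (gen 3 #3 `DiscreteDecomposition`, #4 `KoopmanUnitary`, handed over
while this file was written): #4 discharges `R_unitary` for `H := Lp ℂ 2 μ` in the `DomMulAct` typing (carrier group
`Gᵈᵐᵃ`); this file does it in the `G`-typing of gen 3's own carriers (`torus : Tι → G`, `omg : G → …`), which is the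
typing PerL's translation law `R(h₀)E^χ_f = E^χ_{f^{h₀}}` needs — the two operators agree
(`RegularRep.koopman_eq_domMulAct_smul`).  #3 reduces `discreteDecomp` to a compact approximation; that reduction
composes with `RegCoreCarrier.Analytic.discreteDecomp` verbatim (same statement over `C.toRepCoreCarrier.R`).
The discharge that is NEW here is the torus-side one, `AX12_E_transl` = node N23a (this seat's lineage).

Honesty ledger.  (i) The new torus-side DATA (`ν`, `jT`, `β`, `χv`: the Haar measure of `T(𝔸)`, the inclusion
`T(𝔸) → U(W)(𝔸)`, the `T(L₀)`-partition of unity realising `∫_{[T]}`, the characters) are exactly the parameters of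
the landed N23a file; `E` is PerL's `E^χ_f` itself (`N23a.Eis_eq_cosetSum`).  (ii) The structural hypotheses
(`Γ` discrete and closed, `μQ` invariant and finite on compacts, Borel structures) are instance arguments, not fields.
(iii) No analytic axiom other than the two is touched; the remaining twelve are carried verbatim.
-/

noncomputable section

open MeasureTheory
open scoped InnerProductSpace CompactlySupported

namespace HodgeCM

/-! ## 1. The core in the regular-representation model: `RepCoreCarrier` with `H`, `R` defined -/

/-- **Regular-model core carrier**: gen 3's `RepCoreCarrier` with `H := L²(G ⧸ Γ, μQ)` FIXED and WITHOUT the field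
`R` (defined: the regular representation `RegularRep.koopman μQ`).  Prop-free. -/
structure RegCoreCarrier (G : Type) [Group G] [TopologicalSpace G] (Γ : Subgroup G) [MeasurableSpace (G ⧸ Γ)]
    (μQ : Measure (G ⧸ Γ)) (HG CG SK SigIdxG : Type)
    [NormedAddCommGroup HG] [InnerProductSpace ℂ HG] [CompleteSpace HG]
    [NormedAddCommGroup CG] [NormedSpace ℂ CG] [TopologicalSpace SK] where
  /-- the Weil action `ω(h)` on the index set `𝒮^κ` -/
  omg : G → SK → SK
  /-- the theta kernel operators `𝒯_Φ : L²([U(W)]) → C([G_U])` -/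
  TΦc : SK → (Lp ℂ 2 μQ →L[ℂ] CG)
  /-- the bounded inclusion `C([G_U]) ⊆ L²([G_U])` -/
  inclCG : CG →L[ℂ] HG
  /-- AX1b(a): the isotypic components of `L²([G_U])` -/
  hatτ : SigIdxG → Submodule ℂ HG

namespace RegCoreCarrier

variable {G : Type} [Group G] [TopologicalSpace G] [IsTopologicalGroup G] [MeasurableSpace G] [BorelSpace G]
variable {Γ : Subgroup G} [MeasurableSpace (G ⧸ Γ)] [BorelSpace (G ⧸ Γ)]
variable {μQ : Measure (G ⧸ Γ)} [SMulInvariantMeasure G (G ⧸ Γ) μQ]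
variable {HG CG SK SigIdxG : Type}
variable [NormedAddCommGroup HG] [InnerProductSpace ℂ HG] [CompleteSpace HG]
variable [NormedAddCommGroup CG] [NormedSpace ℂ CG] [TopologicalSpace SK]
variable (C : RegCoreCarrier G Γ μQ HG CG SK SigIdxG)

/-- **The gen-3 core of a regular-model core**: `R :=` the regular representation on `L²(G ⧸ Γ, μQ)`. -/
def toRepCoreCarrier : RepCoreCarrier (Lp ℂ 2 μQ) HG CG G SK SigIdxG where
  R := RegularRep.koopman μQ
  omg := C.omg
  TΦc := C.TΦc
  inclCG := C.inclCG
  hatτ := C.hatτ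

/-- (Ported verbatim from the HodgeCMPerL package; no docstring in the source.) -/
@[simp] theorem toRepCoreCarrier_R : C.toRepCoreCarrier.R = RegularRep.koopman μQ := rfl
/-- (Ported verbatim from the HodgeCMPerL package; no docstring in the source.) -/
@[simp] theorem toRepCoreCarrier_omg : C.toRepCoreCarrier.omg = C.omg := rfl
/-- (Ported verbatim from the HodgeCMPerL package; no docstring in the source.) -/
@[simp] theorem toRepCoreCarrier_TΦc : C.toRepCoreCarrier.TΦc = C.TΦc := rfl
/-- (Ported verbatim from the HodgeCMPerL package; no docstring in the source.) -/
@[simp] theorem toRepCoreCarrier_inclCG : C.toRepCoreCarrier.inclCG = C.inclCG := rfl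
/-- (Ported verbatim from the HodgeCMPerL package; no docstring in the source.) -/
@[simp] theorem toRepCoreCarrier_hatτ : C.toRepCoreCarrier.hatτ = C.hatτ := rfl

/-- **The remaining analytic axioms of the core — 2 of gen 3's 3** (`R_unitary` is a theorem:
`toRepCoreCarrier_analytic`).  Field statements verbatim gen 3's, over the gen-3 core of `C`. -/
structure Analytic : Prop where
  /-- discrete decomposition of `L²([U(W)])` under the regular representation (gen 3's field and citation,
  `RepCoreCarrier.Analytic.discreteDecomp`, verbatim) -/
  discreteDecomp :
    (⨆ V : RepDecomp.Irr C.toRepCoreCarrier.R, (V.1 : Submodule ℂ (Lp ℂ 2 μQ))).topologicalClosure = ⊤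
  /-- AX1b(a) (ll. 264–268): completeness of the `G_U`-side decomposition (unchanged). -/
  hatτ_complete : (⨆ j, C.hatτ j).topologicalClosure = ⊤

variable {C}

/-- **Gen 3's three core axioms from the two**: `R_unitary` is PROVED — the regular representation of a
measure-preserving action is by linear isometries (`RegularRep.koopman_inner`). -/
theorem toRepCoreCarrier_analytic (h : C.Analytic) : C.toRepCoreCarrier.Analytic where
  R_unitary := fun g u v => RegularRep.koopman_inner μQ g u v
  discreteDecomp := h.discreteDecomp
  hatτ_complete := h.hatτ_complete

end RegCoreCarrier

/-! ## 2. One torus side in the regular model: `RepTorusCarrier` with `TestFn`, `E`, `ETransl` defined -/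

/-- **Regular-model torus carrier**: gen 3's `RepTorusCarrier` WITHOUT the fields `TestFn`, `E`, `ETransl`, WITH
the prop-free data they are defined from (the parameters of node N23a, `PerL34/PseudoEisenstein.lean`): the torus
`T = T(𝔸)` with its measure `ν`, the continuous homomorphism `jT : T(𝔸) → U(W)(𝔸)`, the compactly supported weight
`β` realising `∫_{[T]}` (`[T]` compact, tex l. 408), and the characters `χ` as continuous functions on `T(𝔸)`. -/
structure RegTorusCarrier {G : Type} [Group G] [TopologicalSpace G] {Γ : Subgroup G} [MeasurableSpace (G ⧸ Γ)]
    {μQ : Measure (G ⧸ Γ)} {HG CG SK SigIdxG : Type}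
    [NormedAddCommGroup HG] [InnerProductSpace ℂ HG] [CompleteSpace HG]
    [NormedAddCommGroup CG] [NormedSpace ℂ CG] [TopologicalSpace SK]
    (C : RegCoreCarrier G Γ μQ HG CG SK SigIdxG)
    (T : Type) [Group T] [TopologicalSpace T] [MeasurableSpace T] where
  /-- the characters `χ` of `[T]` with `χ_∞ = w` — bare index type -/
  X : Type
  /-- `χ` arises from an allowed pair -/
  allowed : X → Prop
  /-- the toric periods `ϑ_{T,χ}(Φ) ∈ C([G_U])` -/
  ϑc : X → SK → CG
  /-- index type of the elements of the compact torus `T(L₀ ⊗ ℝ)` (ll. 387–388) -/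
  Tι : Type
  /-- the compact torus inside `U(W)(𝔸)` -/
  torus : Tι → G
  /-- the weight (character) `w` of `T(L₀ ⊗ ℝ)` (l. 387) -/
  w : Tι → ℂ
  /-- the Haar measure of `T(𝔸)` -/
  ν : Measure T
  /-- the inclusion `T(𝔸) → U(W)(𝔸)` -/
  jT : ContinuousMonoidHom T G
  /-- the `T(L₀)`-partition of unity realising `∫_{[T]} F = ∫_T β F dν` (N23a model; `[T]` compact) -/
  β : C_c(T, ℝ)
  /-- the character `χ` indexed by `x : X`, as a continuous function on `T(𝔸)` -/
  χv : X → C(T, ℂ)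

namespace RegTorusCarrier

variable {G : Type} [Group G] [TopologicalSpace G] [IsTopologicalGroup G] [T2Space G] [LocallyCompactSpace G]
  [MeasurableSpace G] [BorelSpace G]
variable {Γ : Subgroup G} [DiscreteTopology Γ] [IsClosed (Γ : Set G)] [MeasurableSpace (G ⧸ Γ)] [BorelSpace (G ⧸ Γ)]
variable {μQ : Measure (G ⧸ Γ)} [SMulInvariantMeasure G (G ⧸ Γ) μQ] [IsFiniteMeasureOnCompacts μQ]
variable {HG CG SK SigIdxG : Type}
variable [NormedAddCommGroup HG] [InnerProductSpace ℂ HG] [CompleteSpace HG]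
variable [NormedAddCommGroup CG] [NormedSpace ℂ CG] [TopologicalSpace SK]
variable {C : RegCoreCarrier G Γ μQ HG CG SK SigIdxG}
variable {T : Type} [Group T] [TopologicalSpace T] [MeasurableSpace T] [OpensMeasurableSpace T]
variable (D : RegTorusCarrier C T) [IsFiniteMeasureOnCompacts D.ν]

/-- **`E^χ_f`, DEFINED** (ll. 405–409): the pseudo-Eisenstein vector of `f ∈ C_c(U(W)(𝔸))` in `L²([U(W)])`. -/
def E (x : D.X) (f : C_c(G, ℂ)) : Lp ℂ 2 μQ :=
  RegularRep.EisL2 μQ D.ν D.jT D.β (D.χv x) (RegularRep.discreteMeets_of_discrete Γ) f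

/-- **The gen-3 torus carrier of a regular-model one.** -/
def toRepTorusCarrier : RepTorusCarrier C.toRepCoreCarrier where
  X := D.X
  TestFn := C_c(G, ℂ)
  allowed := D.allowed
  ϑc := D.ϑc
  E := D.E
  Tι := D.Tι
  torus := D.torus
  w := D.w
  ETransl := fun h _ f => RegularRep.rTransCc f h

/-- (Ported verbatim from the HodgeCMPerL package; no docstring in the source.) -/
@[simp] theorem toRepTorusCarrier_X : D.toRepTorusCarrier.X = D.X := rfl
/-- (Ported verbatim from the HodgeCMPerL package; no docstring in the source.) -/
@[simp] theorem toRepTorusCarrier_TestFn : D.toRepTorusCarrier.TestFn = C_c(G, ℂ) := rfl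
/-- (Ported verbatim from the HodgeCMPerL package; no docstring in the source.) -/
@[simp] theorem toRepTorusCarrier_ϑc : D.toRepTorusCarrier.ϑc = D.ϑc := rfl
/-- (Ported verbatim from the HodgeCMPerL package; no docstring in the source.) -/
@[simp] theorem toRepTorusCarrier_E : D.toRepTorusCarrier.E = D.E := rfl
/-- (Ported verbatim from the HodgeCMPerL package; no docstring in the source.) -/
@[simp] theorem toRepTorusCarrier_torus : D.toRepTorusCarrier.torus = D.torus := rfl
/-- (Ported verbatim from the HodgeCMPerL package; no docstring in the source.) -/
@[simp] theorem toRepTorusCarrier_w : D.toRepTorusCarrier.w = D.w := rfl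
/-- (Ported verbatim from the HodgeCMPerL package; no docstring in the source.) -/
theorem toRepTorusCarrier_ETransl (h : G) (x : D.X) (f : C_c(G, ℂ)) :
    D.toRepTorusCarrier.ETransl h x f = RegularRep.rTransCc f h := rfl

/-- **N23a = `AX12_E_transl`, PROVED in the regular model** (tex ll. 410–411): `R(h₀) E^χ_f = E^χ_{f^{h₀}}`. -/
theorem AX12_E_transl_holds (h : G) (x : D.X) (f : C_c(G, ℂ)) :
    C.toRepCoreCarrier.R h (D.E x f) = D.E x (RegularRep.rTransCc f h) :=
  RegularRep.koopman_EisL2 μQ D.ν D.jT D.β (D.χv x) _ h f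

/-- **The remaining analytic axioms of one torus side — 5 of gen 3's 6** (`AX12_E_transl` is a theorem:
`toRepTorusCarrier_analytic`).  Field statements verbatim gen 3's, over the gen-3 carrier of `D`. -/
structure Analytic : Prop where
  /-- AX5b: `Φ ↦ ϑ_{T,χ}(Φ)` is continuous into `C([G_U])`. -/
  AX5b_ϑ_cont : ∀ χ, Continuous (D.ϑc χ)
  /-- AX12: `h ↦ ϑ_{T,χ}(ω(h)Φ)` is continuous `U(W)(𝔸) → C([G_U])`. -/
  AX12_transl_cont : ∀ χ (Φ : SK), Continuous fun h : G => D.ϑc χ (C.omg h Φ)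
  /-- AX12, first unfolding identity, integral-free. -/
  AX12_unfold_lift : ∀ (Φ : SK) χ f, (C.toRepCoreCarrier.toCoreCarrier.TΦ Φ) (D.E χ f) ∈ (Submodule.span ℂ
    (Set.range fun h : G => C.inclCG (D.ϑc χ (C.omg h Φ)))).topologicalClosure
  /-- AX12 + AX5b, the approximate-identity limit of Thm 3.7's proof. -/
  AX12_molly : ∀ χ (Φ : SK),
    C.inclCG (D.ϑc χ Φ) ∈ closure (Set.range fun f : C_c(G, ℂ) => (C.toRepCoreCarrier.toCoreCarrier.TΦ Φ) (D.E χ f))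
  /-- Prop 3.6 Step 2 (ll. 423–434): a vector orthogonal to every `E^χ_f` has vanishing `w`-isotypic part. -/
  AX8_annihilation : ∀ v : Lp ℂ 2 μQ, (∀ χ f, ⟪D.E χ f, v⟫_ℂ = 0) → D.toRepTorusCarrier.toTorusCarrier.Pw v = 0

variable {D}

/-- **Gen 3's six torus-side axioms from the five**: `AX12_E_transl` is PROVED (`AX12_E_transl_holds`, from the
landed N23a translation law `PerL34.N23a.Eis_rTrans`). -/
theorem toRepTorusCarrier_analytic (hD : D.Analytic) : D.toRepTorusCarrier.Analytic where
  AX5b_ϑ_cont := hD.AX5b_ϑ_cont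
  AX12_transl_cont := hD.AX12_transl_cont
  AX12_E_transl := fun h x f => D.AX12_E_transl_holds h x f
  AX12_unfold_lift := hD.AX12_unfold_lift
  AX12_molly := hD.AX12_molly
  AX8_annihilation := hD.AX8_annihilation

end RegTorusCarrier

/-! ## 3. The universe-indexed carrier in the regular model and its theta model -/

namespace Universe

open HodgeCM.Prior.Perl34File HodgeCM.Prior.Perl34File.Perl34

variable (U : Universe)

/-- **The regular-model theta carrier**: gen 3's `U.RepThetaCarrier` WITHOUT the family `H` (defined:
`L²(G ⧸ Γ, μQ)`), with `core`/`t12`/`t34` the regular-model carriers.  New prop-free data per context: the discrete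
closed subgroup `Γ = U(W)(L₀)` of `G = U(W)(𝔸)`, the invariant measure `μQ` of `[U(W)]`, the tori `T12`, `T34`.
The bracketed fields are structural instances (group / topology / Borel / invariance / finiteness on compacts).
NO propositional content beyond them. -/
structure RegThetaCarrier where
  /-- `L²([G_U])` -/
  HG : ∀ (L : CMField) (ι₁ : L →+* ℂ), HermSpace3 L ι₁ → Type
  [instHG₁ : ∀ L ι₁ V, NormedAddCommGroup (HG L ι₁ V)]
  [instHG₂ : ∀ L ι₁ V, InnerProductSpace ℂ (HG L ι₁ V)]
  [instHG₃ : ∀ L ι₁ V, CompleteSpace (HG L ι₁ V)]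
  /-- degree-two classes of `P_Γ` as `L²` functions on `[G_U]` -/
  emb : ∀ {L : CMField} {ι₁ : L →+* ℂ} {V : HermSpace3 L ι₁} (Γ : Level V),
    U.CohC (U.pms L ι₁ V Γ) 2 →ₗ[ℂ] HG L ι₁ V
  /-- the covering `P_{Γ'} → P_Γ` for `Γ' ≤ Γ` -/
  cover : ∀ {L : CMField} {ι₁ : L →+* ℂ} {V : HermSpace3 L ι₁} (Γ Γ' : Level V),
    Γ'.Γ ≤ Γ.Γ → U.Mor (U.pms L ι₁ V Γ') (U.pms L ι₁ V Γ)
  /-- sign recipe, first half -/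
  kappa : ∀ (K L : CMField), (K →+* L) → (L →+* ℂ) → (L →+* ℂ) → (K →+* ℂ)
  /-- sign recipe, second half -/
  frameSign : ∀ (L : CMField), (L →+* ℂ) → (L →+* ℂ) → Bool
  /-- `C([G_U])` -/
  CG : ∀ {L : CMField} {ι₁ : L →+* ℂ}, HermSpace3 L ι₁ → SeesawCtx L → Type
  /-- `U(W)(𝔸)` -/
  G : ∀ {L : CMField} {ι₁ : L →+* ℂ}, HermSpace3 L ι₁ → SeesawCtx L → Type
  /-- `𝒮^κ` -/
  SK : ∀ {L : CMField} {ι₁ : L →+* ℂ}, HermSpace3 L ι₁ → SeesawCtx L → Type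
  /-- index type of the isotypic decomposition of `L²([G_U])` -/
  SigIdxG : ∀ {L : CMField} {ι₁ : L →+* ℂ}, HermSpace3 L ι₁ → SeesawCtx L → Type
  [instCG₁ : ∀ {L : CMField} {ι₁ : L →+* ℂ} (V : HermSpace3 L ι₁) (c : SeesawCtx L), NormedAddCommGroup (CG V c)]
  [instCG₂ : ∀ {L : CMField} {ι₁ : L →+* ℂ} (V : HermSpace3 L ι₁) (c : SeesawCtx L), NormedSpace ℂ (CG V c)]
  [instG₁ : ∀ {L : CMField} {ι₁ : L →+* ℂ} (V : HermSpace3 L ι₁) (c : SeesawCtx L), Group (G V c)]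
  [instG₂ : ∀ {L : CMField} {ι₁ : L →+* ℂ} (V : HermSpace3 L ι₁) (c : SeesawCtx L), TopologicalSpace (G V c)]
  [instG₃ : ∀ {L : CMField} {ι₁ : L →+* ℂ} (V : HermSpace3 L ι₁) (c : SeesawCtx L), IsTopologicalGroup (G V c)]
  [instG₄ : ∀ {L : CMField} {ι₁ : L →+* ℂ} (V : HermSpace3 L ι₁) (c : SeesawCtx L), T2Space (G V c)]
  [instG₅ : ∀ {L : CMField} {ι₁ : L →+* ℂ} (V : HermSpace3 L ι₁) (c : SeesawCtx L), LocallyCompactSpace (G V c)]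
  [instG₆ : ∀ {L : CMField} {ι₁ : L →+* ℂ} (V : HermSpace3 L ι₁) (c : SeesawCtx L), MeasurableSpace (G V c)]
  [instG₇ : ∀ {L : CMField} {ι₁ : L →+* ℂ} (V : HermSpace3 L ι₁) (c : SeesawCtx L), BorelSpace (G V c)]
  [instSK : ∀ {L : CMField} {ι₁ : L →+* ℂ} (V : HermSpace3 L ι₁) (c : SeesawCtx L), TopologicalSpace (SK V c)]
  /-- `U(W)(L₀)`, a discrete closed subgroup of `U(W)(𝔸)` -/
  Gam : ∀ {L : CMField} {ι₁ : L →+* ℂ} (V : HermSpace3 L ι₁) (c : SeesawCtx L), Subgroup (G V c)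
  [instΓ₁ : ∀ {L : CMField} {ι₁ : L →+* ℂ} (V : HermSpace3 L ι₁) (c : SeesawCtx L), DiscreteTopology (Gam V c)]
  [instΓ₂ : ∀ {L : CMField} {ι₁ : L →+* ℂ} (V : HermSpace3 L ι₁) (c : SeesawCtx L),
    IsClosed ((Gam V c : Subgroup (G V c)) : Set (G V c))]
  [instQ₁ : ∀ {L : CMField} {ι₁ : L →+* ℂ} (V : HermSpace3 L ι₁) (c : SeesawCtx L),
    MeasurableSpace (G V c ⧸ Gam V c)]
  [instQ₂ : ∀ {L : CMField} {ι₁ : L →+* ℂ} (V : HermSpace3 L ι₁) (c : SeesawCtx L),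
    BorelSpace (G V c ⧸ Gam V c)]
  /-- the invariant measure of `[U(W)] = U(W)(L₀)\U(W)(𝔸)` (realised on `G ⧸ Γ`) -/
  μQ : ∀ {L : CMField} {ι₁ : L →+* ℂ} (V : HermSpace3 L ι₁) (c : SeesawCtx L), Measure (G V c ⧸ Gam V c)
  [instμ₁ : ∀ {L : CMField} {ι₁ : L →+* ℂ} (V : HermSpace3 L ι₁) (c : SeesawCtx L),
    SMulInvariantMeasure (G V c) (G V c ⧸ Gam V c) (μQ V c)]
  [instμ₂ : ∀ {L : CMField} {ι₁ : L →+* ℂ} (V : HermSpace3 L ι₁) (c : SeesawCtx L),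
    IsFiniteMeasureOnCompacts (μQ V c)]
  /-- `T₁₂(𝔸)` -/
  T12 : ∀ {L : CMField} {ι₁ : L →+* ℂ}, HermSpace3 L ι₁ → SeesawCtx L → Type
  /-- `T₃₄(𝔸)` -/
  T34 : ∀ {L : CMField} {ι₁ : L →+* ℂ}, HermSpace3 L ι₁ → SeesawCtx L → Type
  [instT12₁ : ∀ {L : CMField} {ι₁ : L →+* ℂ} (V : HermSpace3 L ι₁) (c : SeesawCtx L), Group (T12 V c)]
  [instT12₂ : ∀ {L : CMField} {ι₁ : L →+* ℂ} (V : HermSpace3 L ι₁) (c : SeesawCtx L), TopologicalSpace (T12 V c)]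
  [instT12₃ : ∀ {L : CMField} {ι₁ : L →+* ℂ} (V : HermSpace3 L ι₁) (c : SeesawCtx L), MeasurableSpace (T12 V c)]
  [instT12₄ : ∀ {L : CMField} {ι₁ : L →+* ℂ} (V : HermSpace3 L ι₁) (c : SeesawCtx L),
    OpensMeasurableSpace (T12 V c)]
  [instT34₁ : ∀ {L : CMField} {ι₁ : L →+* ℂ} (V : HermSpace3 L ι₁) (c : SeesawCtx L), Group (T34 V c)]
  [instT34₂ : ∀ {L : CMField} {ι₁ : L →+* ℂ} (V : HermSpace3 L ι₁) (c : SeesawCtx L), TopologicalSpace (T34 V c)]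
  [instT34₃ : ∀ {L : CMField} {ι₁ : L →+* ℂ} (V : HermSpace3 L ι₁) (c : SeesawCtx L), MeasurableSpace (T34 V c)]
  [instT34₄ : ∀ {L : CMField} {ι₁ : L →+* ℂ} (V : HermSpace3 L ι₁) (c : SeesawCtx L),
    OpensMeasurableSpace (T34 V c)]
  /-- the regular-model core of the context -/
  core : ∀ {L : CMField} {ι₁ : L →+* ℂ} (V : HermSpace3 L ι₁) (c : SeesawCtx L),
    RegCoreCarrier (G V c) (Gam V c) (μQ V c) (HG L ι₁ V) (CG V c) (SK V c) (SigIdxG V c)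
  /-- the (12) torus side -/
  t12 : ∀ {L : CMField} {ι₁ : L →+* ℂ} (V : HermSpace3 L ι₁) (c : SeesawCtx L), RegTorusCarrier (core V c) (T12 V c)
  /-- the (34) torus side -/
  t34 : ∀ {L : CMField} {ι₁ : L →+* ℂ} (V : HermSpace3 L ι₁) (c : SeesawCtx L), RegTorusCarrier (core V c) (T34 V c)
  [instν12 : ∀ {L : CMField} {ι₁ : L →+* ℂ} (V : HermSpace3 L ι₁) (c : SeesawCtx L),
    IsFiniteMeasureOnCompacts (t12 V c).ν]
  [instν34 : ∀ {L : CMField} {ι₁ : L →+* ℂ} (V : HermSpace3 L ι₁) (c : SeesawCtx L),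
    IsFiniteMeasureOnCompacts (t34 V c).ν]
  /-- the theta one-forms of type `Ψ_i` at level `Γ` -/
  Theta : ∀ {L : CMField} {ι₁ : L →+* ℂ} (V : HermSpace3 L ι₁), SeesawCtx L → Fin 4 → ∀ Γ : Level V,
    Set (U.CohC (U.pms L ι₁ V Γ) 1)

attribute [instance] RegThetaCarrier.instHG₁ RegThetaCarrier.instHG₂ RegThetaCarrier.instHG₃
  RegThetaCarrier.instCG₁ RegThetaCarrier.instCG₂ RegThetaCarrier.instG₁ RegThetaCarrier.instG₂
  RegThetaCarrier.instG₃ RegThetaCarrier.instG₄ RegThetaCarrier.instG₅ RegThetaCarrier.instG₆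
  RegThetaCarrier.instG₇ RegThetaCarrier.instSK RegThetaCarrier.instΓ₁ RegThetaCarrier.instΓ₂
  RegThetaCarrier.instQ₁ RegThetaCarrier.instQ₂ RegThetaCarrier.instμ₁ RegThetaCarrier.instμ₂
  RegThetaCarrier.instT12₁ RegThetaCarrier.instT12₂ RegThetaCarrier.instT12₃ RegThetaCarrier.instT12₄
  RegThetaCarrier.instT34₁ RegThetaCarrier.instT34₂ RegThetaCarrier.instT34₃ RegThetaCarrier.instT34₄
  RegThetaCarrier.instν12 RegThetaCarrier.instν34

namespace RegThetaCarrier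

variable {U} (D : U.RegThetaCarrier)

/-- **The gen-3 carrier of a regular-model one**: `H V c := L²(G ⧸ Γ, μQ)`, cores and torus sides converted.
(Reducible, so that the structural instances of `D` are found on `D.toRepThetaCarrier.G V c` etc.) -/
abbrev toRepThetaCarrier : U.RepThetaCarrier where
  HG := D.HG
  emb := D.emb
  cover := D.cover
  kappa := D.kappa
  frameSign := D.frameSign
  H := fun V c => Lp ℂ 2 (D.μQ V c)
  CG := D.CG
  G := D.G
  SK := D.SK
  SigIdxG := D.SigIdxG
  core := fun V c => (D.core V c).toRepCoreCarrier
  t12 := fun V c => (D.t12 V c).toRepTorusCarrier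
  t34 := fun V c => (D.t34 V c).toRepTorusCarrier
  Theta := D.Theta

/-- **The analytic hypotheses of a regular-model carrier: 2 + 5 + 5 = 12 named propositions per context.** -/
structure Analytic : Prop where
  core : ∀ {L : CMField} {ι₁ : L →+* ℂ} (V : HermSpace3 L ι₁) (c : SeesawCtx L), (D.core V c).Analytic
  t12 : ∀ {L : CMField} {ι₁ : L →+* ℂ} (V : HermSpace3 L ι₁) (c : SeesawCtx L), (D.t12 V c).Analytic
  t34 : ∀ {L : CMField} {ι₁ : L →+* ℂ} (V : HermSpace3 L ι₁) (c : SeesawCtx L), (D.t34 V c).Analytic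

variable {D}

/-- **Gen 3's fifteen axioms per context from the twelve** (`R_unitary`, `AX12_E_transl` ×2 are theorems). -/
theorem Analytic.toRepThetaCarrier (hA : D.Analytic) : D.toRepThetaCarrier.Analytic where
  core := fun V c => RegCoreCarrier.toRepCoreCarrier_analytic (hA.core V c)
  t12 := fun V c => RegTorusCarrier.toRepTorusCarrier_analytic (hA.t12 V c)
  t34 := fun V c => RegTorusCarrier.toRepTorusCarrier_analytic (hA.t34 V c)

end RegThetaCarrier

namespace ThetaModel

variable {U}

/-- **The theta model of a regular-model carrier.** -/
def ofRegCarrier (D : U.RegThetaCarrier) (hA : D.Analytic) : U.ThetaModel :=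
  ofRepCarrier D.toRepThetaCarrier hA.toRepThetaCarrier


-- port_pkg: scope closed for this part
end ThetaModel
end Universe
end HodgeCM
end
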